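import Mathlib
import Summits.AnomalousDissipation.AnomalousDissipation.Theses.MomentParity
import Literature.Analysis.FluidPDE.GalerkinFlow
import Summits.AnomalousDissipation.AnomalousDissipation.Theorems.QuarticGate.Negative.LevelCeiling
import Summits.AnomalousDissipation.AnomalousDissipation.Theorems.QuarticGate.Negative.EnergyRow

/-!
# Sketch — crux-ideate stmt-AnomalousDissipation-14331 (`MomentParity.QuarticTightness`), round 1, ideator 3

First lemmas of the idea cards `horizon-shooting` and `certificate-completeness`, typed over existing
declarations, plus the (proved) transfer `quarticTightness_of_universalFloor` both cards rest on.
Nothing here is a route item; `sorry` appears only in statements marked FIRST LEMMA (they are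
`def … : Prop`, so in fact no `sorry` is needed at all).
-/

namespace Summit.AnomalousDissipation.AnomalousDissipation.Cruxes.QuarticTightness.Ideate3

open MeasureTheory Filter Topology
open scoped ENNReal InnerProductSpace RealInnerProductSpace
open Literature.Analysis.FunctionSpaces Literature.Analysis.FluidPDE
open Summit.AnomalousDissipation.AnomalousDissipation.Theses.MomentParity
open Summit.AnomalousDissipation.AnomalousDissipation.Theorems.QuarticGate.Negative

noncomputable section

/-! ## 0. Vocabulary: the conclusion of `QuarticTightness`, named -/

/-- The level-`N` ladder-witness clauses of the CONCLUSION of `QuarticTightness` (= the `MomentLadder`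
body minus the resolution clause): probability, level-`N` a.s., support in `‖u‖ ≤ R`, `d`-stationary,
energy `≤ E'`, dissipation `≥ ε'`. Verbatim clauses, named with the sibling crux's vocabulary. -/
def IsLadderWitness (f : UnitAddTorus (Fin 3) → EuclideanSpace ℝ (Fin 3)) (ν : ℝ) (N : ℕ)
    (R E' ε' : ℝ) (d : ℕ) (μ : Measure (Torus.energySpace (Fin 3))) : Prop :=
  IsProbabilityMeasure μ ∧ (∀ᵐ u ∂μ, IsLevel N u) ∧ (∀ᵐ u ∂μ, ‖u‖ ≤ R) ∧
    IsPolyStationary ν f N d μ ∧ Torus.ensembleEnergy μ ≤ E' ∧ ε' ≤ Torus.ensembleDissipation ν μ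

/-- `EnsembleFloor f ν`: the conclusion of `QuarticTightness` at the force `f` along the viscosities `ν`
(free budgets `E', ε'`; via MomentClosure-type compactness ≡ loud Galerkin-INVARIANT laws in the
absorbing ball, `N`-frequently, at every `ν j`). -/
def EnsembleFloor (f : UnitAddTorus (Fin 3) → EuclideanSpace ℝ (Fin 3)) (ν : ℕ → ℝ) : Prop :=
  ∃ E' ε' : ℝ, 0 < ε' ∧ ∀ j : ℕ, ∃ R : ℝ, ∃ᶠ N in atTop, ∀ d : ℕ,
    ∃ μ : Measure (Torus.energySpace (Fin 3)), IsLadderWitness f (ν j) N R E' ε' d μ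

/-- **UNIVERSAL ENSEMBLE FLOOR** (the transfer target `C⁺` of both cards): every nonzero smooth
divergence-free mean-zero steady force has, along every positive null sequence of viscosities, loud
bounded-energy Galerkin ensembles at all moment orders with common support — the Galerkin-ensemble
zeroth law with free budgets, for ALL forces (sup over invariant measures: its weakest form). -/
def UniversalEnsembleFloor : Prop :=
  ∀ f : UnitAddTorus (Fin 3) → EuclideanSpace ℝ (Fin 3),
    Torus.IsSmooth f → Torus.IsDivFree f → Torus.HasZeroMean f → f ≠ 0 →
    ∀ ν : ℕ → ℝ, (∀ j, 0 < ν j) → Tendsto ν atTop (𝓝 0) → EnsembleFloor f ν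

/-- `QuarticTightness` restated through the vocabulary (definitional unfolding). -/
theorem quarticTightness_iff :
    QuarticTightness ↔ ∀ f : UnitAddTorus (Fin 3) → EuclideanSpace ℝ (Fin 3),
      Torus.IsSmooth f → Torus.IsDivFree f → Torus.HasZeroMean f →
      ∀ (ν : ℕ → ℝ) (E ε : ℝ), (∀ j, 0 < ν j) → Tendsto ν atTop (𝓝 0) → 0 < ε →
      (∀ j : ℕ, ∃ᶠ N in atTop, ∃ μ, IsQuarticWitness f (ν j) N E ε μ) → EnsembleFloor f ν :=
  Iff.rfl

/-- **TRANSFER (proved): the universal ensemble floor implies the crux.** The order-4 hypothesis is used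
only to exclude `f = 0` (energy row `ε ≤ ‖f‖₂ √E` of the sibling crux's certified negative file). -/
theorem quarticTightness_of_universalFloor (h : UniversalEnsembleFloor) : QuarticTightness := by
  rw [quarticTightness_iff]
  intro f hfs hfd hfz ν E ε hν hν0 hε hH
  have hf0 : f ≠ 0 := by
    intro hf
    subst hf
    obtain ⟨N, μ, hμ⟩ := (hH 0).exists
    have key := hμ.eps_le_force (f := 0) (by simpa using (memLp_const (0 : EuclideanSpace ℝ (Fin 3))))
    simp at key
    linarith
  exact h f hfs hfd hfz hf0 ν hν hν0

/-! ## 1. FIRST LEMMA of card `horizon-shooting`: moving-base Krylov–Bogoliubov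

Finite-horizon loudness with horizon-uniform budgets ⇒ a loud bounded invariant probability measure.
Abstract form over Mathlib's `Flow`; the Galerkin instance takes `X` = the absorbing ball of level-`N`
Galerkin NS at `(ν, P_N f)` (compact, forward invariant), `g u = (f,u)` and `e u = ‖u‖²`. -/

/-- **Moving-base Krylov–Bogoliubov.** For a continuous flow on a compact metric space and continuous
observables `g, e`: if for every horizon `T > 0` SOME initial point has window-averaged `g ≥ c` and
`e ≤ E`, then an invariant Borel probability measure has `∫ g ≥ c` and `∫ e ≤ E` (weak-* limit of the
empirical measures of the good windows; the boundary term is `O(1/T)` whatever the base point). -/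
def MovingBaseKrylovBogoliubov : Prop :=
  ∀ (X : Type) [MetricSpace X] [CompactSpace X] [MeasurableSpace X] [BorelSpace X]
    (ϕ : Flow ℝ X) (g e : X → ℝ), Continuous g → Continuous e → ∀ c E : ℝ,
    (∀ T : ℝ, 0 < T → ∃ x : X,
        c * T ≤ ∫ t in (0 : ℝ)..T, g (ϕ t x) ∧ ∫ t in (0 : ℝ)..T, e (ϕ t x) ≤ E * T) →
    ∃ μ : Measure X, IsProbabilityMeasure μ ∧ (∀ t : ℝ, Measure.map (ϕ t) μ = μ) ∧
      c ≤ ∫ x, g x ∂μ ∧ ∫ x, e x ∂μ ≤ E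

/-- The exact (multiplier) form: the maximum of `∫ g` over invariant probabilities with `∫ e ≤ E` is
`≥ c` iff for every `λ ≥ 0` and every horizon some window has average `g − λ (e − E) ≥ c`
(Jenkinson 2019 Prop. 2.2 third equality / subadditivity, plus Sion's minimax for the linear
constraint). Only the easy direction `←` is needed by the line; stated as an iff for the record. -/
def HorizonMinimax : Prop :=
  ∀ (X : Type) [MetricSpace X] [CompactSpace X] [Nonempty X] [MeasurableSpace X] [BorelSpace X]
    (ϕ : Flow ℝ X) (g e : X → ℝ), Continuous g → Continuous e → ∀ c E : ℝ,
    ((∃ μ : Measure X, IsProbabilityMeasure μ ∧ (∀ t : ℝ, Measure.map (ϕ t) μ = μ) ∧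
        c ≤ ∫ x, g x ∂μ ∧ ∫ x, e x ∂μ ≤ E) ↔
      ∀ lam : ℝ, 0 ≤ lam → ∀ T : ℝ, 0 < T → ∃ x : X,
        c * T ≤ ∫ t in (0 : ℝ)..T, (g (ϕ t x) - lam * (e (ϕ t x) - E)))

/-- **Finite-horizon loudness at a Galerkin level** (the shooting target of card `horizon-shooting`):
for every horizon `T > 0` some Galerkin mode `a` of order `N` with `‖a‖₂ ≤ R` has, along the Galerkin
semiflow `Torus.galerkinFlow ν f N` (tree, `Literature/Analysis/FluidPDE/GalerkinFlow.lean`),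
window-averaged power input `≥ ε'` and window-averaged energy `≤ E'`. The base point may depend on `T`. -/
def GalerkinHorizonLoud (f : UnitAddTorus (Fin 3) → EuclideanSpace ℝ (Fin 3)) (ν : ℝ) (N : ℕ)
    (R E' ε' : ℝ) : Prop :=
  ∀ T : ℝ, 0 < T → ∃ a : UnitAddTorus (Fin 3) → EuclideanSpace ℝ (Fin 3),
    IsGalerkinMode N a ∧ (∫ x, ‖a x‖ ^ 2) ≤ R ^ 2 ∧
    ε' * T ≤ ∫ t in (0 : ℝ)..T, (∫ x, ⟪f x, Torus.galerkinFlow ν f N t a x⟫_ℝ) ∧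
    ∫ t in (0 : ℝ)..T, (∫ x, ‖Torus.galerkinFlow ν f N t a x‖ ^ 2) ≤ E' * T

/-- **Horizon loudness gives the floor** (the Galerkin instance of `MovingBaseKrylovBogoliubov`, plus:
invariant + compactly supported on level-`N` fields ⇒ `d`-stationary for every `d` with the `Integrable`
clauses, energy identity `ν∫‖∇u‖² = ∫(f,u)` for invariant laws, absorbing radius `‖f‖₂/(4π²ν)`).
Budgets are kept exactly. Provable now (size M–L: measure transport `V_N ≅ ℝⁿ → H`, weak-* limits). -/
def HorizonLoudGivesFloor : Prop :=
  ∀ f : UnitAddTorus (Fin 3) → EuclideanSpace ℝ (Fin 3),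
    Torus.IsSmooth f → Torus.IsDivFree f → Torus.HasZeroMean f →
    ∀ (ν : ℕ → ℝ) (E' ε' : ℝ), (∀ j, 0 < ν j) → 0 < ε' →
    (∀ j : ℕ, ∃ᶠ N in atTop,
      GalerkinHorizonLoud f (ν j) N (Real.sqrt (∫ x, ‖f x‖ ^ 2) / (4 * Real.pi ^ 2 * ν j)) E' ε') →
    EnsembleFloor f ν

/-- **UNIVERSAL HORIZON LOUDNESS** — the XL core of line `horizon-shooting` in primal, finite-time form:
every nonzero smooth steady force admits budgets `E', ε' > 0` such that at every small viscosity,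
`N`-frequently, every horizon has a loud bounded window issued from the absorbing ball. -/
def UniversalHorizonLoud : Prop :=
  ∀ f : UnitAddTorus (Fin 3) → EuclideanSpace ℝ (Fin 3),
    Torus.IsSmooth f → Torus.IsDivFree f → Torus.HasZeroMean f → f ≠ 0 →
    ∀ ν : ℕ → ℝ, (∀ j, 0 < ν j) → Tendsto ν atTop (𝓝 0) →
    ∃ E' ε' : ℝ, 0 < ε' ∧ ∀ j : ℕ, ∃ᶠ N in atTop,
      GalerkinHorizonLoud f (ν j) N (Real.sqrt (∫ x, ‖f x‖ ^ 2) / (4 * Real.pi ^ 2 * ν j)) E' ε'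

/-- Composition of line `horizon-shooting` (kernel-checked): packaging + XL core ⇒ the crux BY NAME. -/
theorem quarticTightness_of_horizonShooting (hKB : HorizonLoudGivesFloor) (hU : UniversalHorizonLoud) :
    QuarticTightness := by
  refine quarticTightness_of_universalFloor ?_
  intro f hfs hfd hfz hf0 ν hν hν0
  obtain ⟨E', ε', hε', hj⟩ := hU f hfs hfd hfz hf0 ν hν hν0
  exact hKB f hfs hfd hfz ν E' ε' hν hε' hj

/-! ## 2. FIRST LEMMA of card `certificate-completeness`: global certificates have Casimir tops

Dual side. A GLOBAL (all of `V_N`) polynomial quietness certificate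
`(f,u) − λ‖u‖² + ⟨F_ν(u), ∇p(u)⟩ ≤ c` forces the top homogeneous component of `p` to have identically
vanishing Galerkin–Euler derivative on level-`N` fields (ray scaling `u ↦ s u`, then the Gaussian–Liouville
sign lemma of line `QuarticGate/recession-cone`, `stub_signLemma`). Iterated with "no Casimir of degree
≥ 3" it peels every global polynomial certificate down to the background class `αE + βH + (g,u)`. -/

/-- The Galerkin–Euler derivative `{p, B_N}(u) = ⟨−B(u,u), ∇p(u)⟩` of the cylindrical polynomial
observable `p(u) = P((u,g₁),…,(u,gₘ))`: the generator pairing at `ν = 0`, `f = 0`. -/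
def eulerDeriv {m : ℕ} (g : Fin m → UnitAddTorus (Fin 3) → EuclideanSpace ℝ (Fin 3))
    (P : MvPolynomial (Fin m) ℝ) (u : Torus.energySpace (Fin 3)) : ℝ :=
  Torus.nsGeneratorPairing 0 0 u (polyGrad g P u)

/-- **Top degree of a global certificate is a Casimir.** If a polynomial cylindrical observable `p` of
total degree `D ≥ 2` with level-`N` band tests makes `(f,u) − λ‖u‖² + ⟨F_ν(u), ∇p(u)⟩` bounded above on
ALL level-`N` fields, then the Euler derivative of its degree-`D` homogeneous component vanishes on
level-`N` fields. -/
def TopDegreeIsCasimir : Prop :=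
  ∀ (N m : ℕ) (g : Fin m → UnitAddTorus (Fin 3) → EuclideanSpace ℝ (Fin 3))
    (P : MvPolynomial (Fin m) ℝ) (ν : ℝ) (f : UnitAddTorus (Fin 3) → EuclideanSpace ℝ (Fin 3))
    (lam c : ℝ), 0 < ν → Torus.IsSmooth f → (∀ i, IsBandTest N (g i)) → 2 ≤ P.totalDegree →
    (∀ u : Torus.energySpace (Fin 3), IsLevel N u →
        Torus.pairing u.1 f - lam * ‖u‖ ^ 2 + Torus.nsGeneratorPairing ν f u (polyGrad g P u) ≤ c) →
    ∀ u : Torus.energySpace (Fin 3), IsLevel N u →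
      eulerDeriv g (MvPolynomial.homogeneousComponent P.totalDegree P) u = 0

/-- **Background certificates are killed by the order-2 content of the hypothesis** (the LP-duality step
that closes the dual line): a level-`N` law with finite fourth moment that is 4-stationary (indeed
3-stationary suffices) integrates every background-class certificate
`(f,u) − λ‖u‖² + ⟨F_ν(u), ∇(α‖u‖² + q(u))⟩ ≤ c` (with `q` a polynomial observable of degree ≤ 2) to
`∫(f,u)dμ − λ∫‖u‖²dμ ≤ c`; with the energy row `ν∫‖∇u‖² = ∫(f,u)` this bounds the dissipation by
`c + λE`. -/
def BackgroundCertificateBound : Prop :=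
  ∀ (N m : ℕ) (g : Fin m → UnitAddTorus (Fin 3) → EuclideanSpace ℝ (Fin 3))
    (P : MvPolynomial (Fin m) ℝ) (ν : ℝ) (f : UnitAddTorus (Fin 3) → EuclideanSpace ℝ (Fin 3))
    (lam c E ε : ℝ) (μ : Measure (Torus.energySpace (Fin 3))),
    0 < ν → 0 ≤ lam → Torus.IsSmooth f → (∀ i, IsBandTest N (g i)) → P.totalDegree ≤ 2 →
    (∀ u : Torus.energySpace (Fin 3), IsLevel N u →
        Torus.pairing u.1 f - lam * ‖u‖ ^ 2 + Torus.nsGeneratorPairing ν f u (polyGrad g P u) ≤ c) →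
    IsQuarticWitness f ν N E ε μ → ε ≤ c + lam * E

end

end Summit.AnomalousDissipation.AnomalousDissipation.Cruxes.QuarticTightness.Ideate3
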